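import Mathlib.Analysis.ODE.ExistUnique
import Mathlib.MeasureTheory.Integral.Prod
import Mathlib.MeasureTheory.Constructions.BorelSpace.Metrizable
import Mathlib.MeasureTheory.Function.StronglyMeasurable.Basic
import HarnessLib

/-!
# Measurable dependence on a parameter in the Picard–Lindelöf theorem

Topic `Analysis/ODE`. Let `(Ω, 𝓜)` be a measurable space and `f : Ω → ℝ → E → E` a family of
time-dependent vector fields on a complete, second-countable normed space `E`, each satisfying the
hypotheses `IsPicardLindelof (f ω) t₀ x₀ a r L K` of Mathlib's Picard–Lindelöf theorem
(`Mathlib.Analysis.ODE.PicardLindelof`) *with the same constants*, and such that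
`(ω, t, x) ↦ f ω t x` is jointly measurable. Then the solution `α_ω : ℝ → E` of
`α' = f ω t α`, `α(t₀) = x`, on `[tmin, tmax]` produced by the Picard iteration depends measurably
on `ω`: **`ω ↦ α_ω(t)` is measurable for every `t`** (`Literature.Analysis.ODE.measurable_picardSolution`), and
`Literature.Analysis.ODE.picardSolution_spec` restates Mathlib's conclusion
(`IsPicardLindelof.exists_eq_forall_mem_Icc_hasDerivWithinAt`) for this particular solution.

Proof: the solution is the fixed point of Mathlib's Picard operator `ODE.FunSpace.next` on the
complete metric space `ODE.FunSpace t₀ x₀ r L` of `L`-Lipschitz curves; by Mathlib's estimate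
`ODE.FunSpace.dist_iterate_next_iterate_next_le` (`dist (nextⁿ α) (nextⁿ β) ≤ (K·T)ⁿ/n! · dist α β`)
the iterates of any starting curve converge to the fixed point, uniformly hence pointwise; each
iterate `α_{n+1}(t) = x + ∫_{t₀}^t f ω τ (αₙ(τ)) dτ` is measurable in `ω` by induction (the integrand
is jointly measurable in `(ω, τ)` because `αₙ` is continuous in `τ` and measurable in `ω`,
Mathlib `measurable_uncurry_of_continuous_of_measurable`; parametric Bochner integrals of jointly
measurable integrands are measurable, Mathlib `StronglyMeasurable.integral_prod_right'`), and a
pointwise limit of measurable maps is measurable (`measurable_of_tendsto_metrizable`).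

This is the deterministic tool behind the adaptedness of Loewner/SLE flows to the Brownian
filtration (`LoewnerAdapted`): the flow at time `t` is a measurable functional of the driving path
up to time `t`.

## Mathlib

Everything used is Mathlib's ODE API (`IsPicardLindelof`, `ODE.picard`, `ODE.FunSpace`,
`ODE.FunSpace.next`, `ODE.hasDerivWithinAt_picard_Icc`); Mathlib has no statement about
measurable (or continuous) dependence of the Picard–Lindelöf solution on a parameter (searched
`PicardLindelof`, `measurable`, `parametric`).

## References

* E. A. Coddington, N. Levinson, *Theory of Ordinary Differential Equations* (1955), Ch. 1, Thm 7.1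
  ff. (successive approximations; dependence on parameters).
* D. W. Stroock, S. R. S. Varadhan, *Multidimensional Diffusion Processes* (1979), §1.1 (measurable
  dependence of ODE solutions on the data). [folklore]
-/

noncomputable section

open Set Filter Topology MeasureTheory Metric Function ODE
open scoped NNReal Nat

namespace Literature.Analysis.ODE

variable {Ω : Type*} {E : Type*} [NormedAddCommGroup E] [NormedSpace ℝ E]
  [CompleteSpace E] {f : Ω → ℝ → E → E} {tmin tmax : ℝ} {t₀ : Icc tmin tmax} {x₀ x : E}
  {a r L K : ℝ≥0}

/-- The **parametrised Picard iterates**: `picardIterate hf hx n ω` is the `n`-th iterate of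
Mathlib's Picard operator `ODE.FunSpace.next` for the field `f ω`, started at the constant curve
`x₀` (the default element of `ODE.FunSpace t₀ x₀ r L`). [folklore] -/
def picardIterate (hf : ∀ ω, IsPicardLindelof (f ω) t₀ x₀ a r L K) (hx : x ∈ closedBall x₀ r)
    (n : ℕ) (ω : Ω) : FunSpace t₀ x₀ r L :=
  (FunSpace.next (hf ω) hx)^[n] default

/-- The **parametrised Picard–Lindelöf solution**: for each `ω`, the (extension by constants to
`ℝ` of the) fixed point of the Picard operator of `f ω` — a solution of `α' = f ω t α`,
`α t₀ = x` on `[tmin, tmax]` (`picardSolution_spec`), chosen by `Classical.choose` from Mathlib's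
`ODE.FunSpace.exists_isFixedPt_next`; it is nevertheless measurable in `ω`
(`measurable_picardSolution`) because it is the limit of the Picard iterates. [folklore] -/
def picardSolution (hf : ∀ ω, IsPicardLindelof (f ω) t₀ x₀ a r L K) (hx : x ∈ closedBall x₀ r)
    (ω : Ω) : ℝ → E :=
  (Classical.choose (FunSpace.exists_isFixedPt_next (hf ω) hx)).compProj

/-- The chosen fixed point is a fixed point. [folklore] -/
theorem isFixedPt_choose (hf : ∀ ω, IsPicardLindelof (f ω) t₀ x₀ a r L K)
    (hx : x ∈ closedBall x₀ r) (ω : Ω) :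
    IsFixedPt (FunSpace.next (hf ω) hx)
      (Classical.choose (FunSpace.exists_isFixedPt_next (hf ω) hx)) :=
  Classical.choose_spec (FunSpace.exists_isFixedPt_next (hf ω) hx)

/-- **The parametrised solution solves the initial value problem** (Mathlib's Picard–Lindelöf
theorem `IsPicardLindelof.exists_eq_forall_mem_Icc_hasDerivWithinAt`, restated for
`picardSolution`): `α_ω(t₀) = x` and `α_ω' = f ω t α_ω` within `[tmin, tmax]`. [folklore] -/
theorem picardSolution_spec (hf : ∀ ω, IsPicardLindelof (f ω) t₀ x₀ a r L K)
    (hx : x ∈ closedBall x₀ r) (ω : Ω) :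
    picardSolution hf hx ω t₀ = x ∧
      ∀ t ∈ Icc tmin tmax, HasDerivWithinAt (picardSolution hf hx ω)
        (f ω t (picardSolution hf hx ω t)) (Icc tmin tmax) t := by
  set α := Classical.choose (FunSpace.exists_isFixedPt_next (hf ω) hx) with hαdef
  have hα : IsFixedPt (FunSpace.next (hf ω) hx) α := isFixedPt_choose hf hx ω
  change α.compProj t₀ = x ∧ ∀ t ∈ Icc tmin tmax,
    HasDerivWithinAt α.compProj (f ω t (α.compProj t)) (Icc tmin tmax) t
  refine ⟨by rw [FunSpace.compProj_val, ← hα, FunSpace.next_apply₀], fun t ht ↦ ?_⟩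
  apply hasDerivWithinAt_picard_Icc t₀.2 (hf ω).continuousOn_uncurry
    α.continuous_compProj.continuousOn (fun _ ht' ↦ α.compProj_mem_closedBall (hf ω).mul_max_le)
    x ht |>.congr_of_mem _ ht
  intro t' ht'
  nth_rw 1 [← hα]
  rw [FunSpace.compProj_of_mem ht', FunSpace.next_apply]

/-- The parametrised solution stays in the closed ball `closedBall x₀ a` where the hypotheses on
the field hold. [folklore] -/
theorem picardSolution_mem_closedBall (hf : ∀ ω, IsPicardLindelof (f ω) t₀ x₀ a r L K)
    (hx : x ∈ closedBall x₀ r) (ω : Ω) (t : ℝ) :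
    picardSolution hf hx ω t ∈ closedBall x₀ a :=
  (Classical.choose (FunSpace.exists_isFixedPt_next (hf ω) hx)).compProj_mem_closedBall
    (hf ω).mul_max_le

/-- The parametrised solution is continuous in time. [folklore] -/
theorem continuous_picardSolution (hf : ∀ ω, IsPicardLindelof (f ω) t₀ x₀ a r L K)
    (hx : x ∈ closedBall x₀ r) (ω : Ω) : Continuous (picardSolution hf hx ω) :=
  (Classical.choose (FunSpace.exists_isFixedPt_next (hf ω) hx)).continuous_compProj

/-- Outside `[tmin, tmax]` the parametrised solution is extended by its boundary values:
`α_ω(t) = α_ω(projIcc t)`. [folklore] -/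
theorem picardSolution_eq_projIcc (hf : ∀ ω, IsPicardLindelof (f ω) t₀ x₀ a r L K)
    (hx : x ∈ closedBall x₀ r) (ω : Ω) (t : ℝ) :
    picardSolution hf hx ω t =
      picardSolution hf hx ω (projIcc tmin tmax (le_trans t₀.2.1 t₀.2.2) t) := by
  simp only [picardSolution, FunSpace.compProj_apply, projIcc_val]

/-- **The Picard iterates converge to the solution** (in the sup metric of `ODE.FunSpace`): by
Mathlib's `dist_iterate_next_iterate_next_le`, `dist (nextⁿ α₀) (nextⁿ α) ≤ (K T)ⁿ/n! · dist α₀ α`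
for the fixed point `α`, and `(K T)ⁿ/n! → 0`. [folklore] -/
theorem tendsto_picardIterate (hf : ∀ ω, IsPicardLindelof (f ω) t₀ x₀ a r L K)
    (hx : x ∈ closedBall x₀ r) (ω : Ω) :
    Tendsto (fun n ↦ picardIterate hf hx n ω) atTop
      (𝓝 (Classical.choose (FunSpace.exists_isFixedPt_next (hf ω) hx))) := by
  set α := Classical.choose (FunSpace.exists_isFixedPt_next (hf ω) hx) with hαdef
  have hα : IsFixedPt (FunSpace.next (hf ω) hx) α := isFixedPt_choose hf hx ω
  rw [tendsto_iff_dist_tendsto_zero]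
  have hb : ∀ n, dist (picardIterate hf hx n ω) α ≤
      (K * max (tmax - t₀) (t₀ - tmin)) ^ n / n ! * dist (default : FunSpace t₀ x₀ r L) α := by
    intro n
    have h := FunSpace.dist_iterate_next_iterate_next_le (hf ω) hx default α n
    rwa [hα.iterate n] at h
  refine squeeze_zero (fun n ↦ dist_nonneg) hb ?_
  simpa using (FloorSemiring.tendsto_pow_div_factorial_atTop
    ((K : ℝ) * max (tmax - t₀) (t₀ - tmin))).mul_const (dist (default : FunSpace t₀ x₀ r L) α)

/-- Pointwise convergence of the Picard iterates to the solution. [folklore] -/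
theorem tendsto_picardIterate_apply (hf : ∀ ω, IsPicardLindelof (f ω) t₀ x₀ a r L K)
    (hx : x ∈ closedBall x₀ r) (ω : Ω) (t : Icc tmin tmax) :
    Tendsto (fun n ↦ picardIterate hf hx n ω t) atTop (𝓝 (picardSolution hf hx ω t)) := by
  have h := tendsto_picardIterate hf hx ω
  rw [picardSolution, FunSpace.compProj_val]
  have hcont : Continuous fun β : FunSpace t₀ x₀ r L ↦ β t :=
    (continuous_eval_const t : Continuous fun g : C(Icc tmin tmax, E) ↦ g t).comp
      FunSpace.isUniformInducing_toContinuousMap.uniformContinuous.continuous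
  exact (hcont.tendsto _).comp h

section Measurable

variable [MeasurableSpace Ω] [MeasurableSpace E] [BorelSpace E] [SecondCountableTopology E]

omit [CompleteSpace E] in
/-- **Each Picard iterate is measurable in the parameter**, when `(ω, t, x) ↦ f ω t x` is jointly
measurable: `α_{n+1}(t) = x + ∫_{t₀}^t f ω τ (αₙ τ) dτ` with an integrand jointly measurable in
`(ω, τ)` (continuous in `τ`, measurable in `ω`), and parametric integrals of jointly measurable
integrands are measurable. [folklore] -/
theorem measurable_picardIterate (hf : ∀ ω, IsPicardLindelof (f ω) t₀ x₀ a r L K)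
    (hx : x ∈ closedBall x₀ r) (hmeas : Measurable fun p : Ω × ℝ × E ↦ f p.1 p.2.1 p.2.2) (n : ℕ)
    (t : Icc tmin tmax) : Measurable fun ω ↦ picardIterate hf hx n ω t := by
  induction n generalizing t with
  | zero =>
    simp only [picardIterate, iterate_zero, id_eq]
    exact measurable_const
  | succ n ih =>
    simp only [picardIterate, iterate_succ_apply'] at ih ⊢
    simp only [FunSpace.next_apply, picard_apply]
    refine Measurable.const_add ?_ x
    -- joint measurability of the integrand `(ω, τ) ↦ f ω τ (αₙ(ω).compProj τ)`
    have hu : Measurable fun p : Ω × ℝ ↦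
        ((FunSpace.next (hf p.1) hx)^[n] default).compProj p.2 := by
      have h1 : Measurable (uncurry fun (τ : ℝ) (ω : Ω) ↦
          ((FunSpace.next (hf ω) hx)^[n] default).compProj τ) :=
        measurable_uncurry_of_continuous_of_measurable
          (fun ω ↦ ((FunSpace.next (hf ω) hx)^[n] default).continuous_compProj)
          (fun τ ↦ by
            simp only [FunSpace.compProj_apply]
            exact ih _)
      exact h1.comp measurable_swap
    have hj : Measurable fun p : Ω × ℝ ↦
        f p.1 p.2 (((FunSpace.next (hf p.1) hx)^[n] default).compProj p.2) :=
      hmeas.comp (measurable_fst.prodMk (measurable_snd.prodMk hu))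
    have hint : ∀ s₁ s₂ : ℝ, Measurable fun ω ↦ ∫ τ in Ioc s₁ s₂,
        f ω τ (((FunSpace.next (hf ω) hx)^[n] default).compProj τ) := fun s₁ s₂ ↦
      (hj.stronglyMeasurable.integral_prod_right'
        (ν := (volume : Measure ℝ).restrict (Ioc s₁ s₂))).measurable
    simp only [intervalIntegral]
    exact (hint _ _).sub (hint _ _)

/-- **Measurable dependence of the Picard–Lindelöf solution on a parameter**: if the fields `f ω`
satisfy Mathlib's `IsPicardLindelof` hypotheses uniformly in `ω` and `(ω, t, x) ↦ f ω t x` is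
jointly measurable, then for every time `t` the solution value `ω ↦ α_ω(t)` is measurable (a
pointwise limit of the measurable Picard iterates). Coddington–Levinson (1955), Ch. 1 §7;
Stroock–Varadhan (1979), §1.1. [folklore] -/
theorem measurable_picardSolution (hf : ∀ ω, IsPicardLindelof (f ω) t₀ x₀ a r L K)
    (hx : x ∈ closedBall x₀ r) (hmeas : Measurable fun p : Ω × ℝ × E ↦ f p.1 p.2.1 p.2.2) (t : ℝ) :
    Measurable fun ω ↦ picardSolution hf hx ω t := by
  have h : ∀ s : Icc tmin tmax, Measurable fun ω ↦ picardSolution hf hx ω s := fun s ↦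
    measurable_of_tendsto_metrizable (fun n ↦ measurable_picardIterate hf hx hmeas n s)
      (tendsto_pi_nhds.2 fun ω ↦ tendsto_picardIterate_apply hf hx ω s)
  have e : (fun ω ↦ picardSolution hf hx ω t) =
      fun ω ↦ picardSolution hf hx ω (projIcc tmin tmax (le_trans t₀.2.1 t₀.2.2) t) :=
    funext fun ω ↦ picardSolution_eq_projIcc hf hx ω t
  rw [e]
  exact h _

end Measurable

end Literature.Analysis.ODE
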